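import Mathlib.RingTheory.Localization.AtPrime.Basic
import Mathlib.RingTheory.Localization.Ideal
import Mathlib.RingTheory.Ideal.Height
import Mathlib.RingTheory.Ideal.MinimalPrime.Localization
import Mathlib.Algebra.CharP.Lemmas
import Summits.ResolutionOfSingularities.ResolutionOfSingularities.Theorems.FrobeniusLadderFInjectiveMacaulayficationFedderCriterion
import Summits.ResolutionOfSingularities.ResolutionOfSingularities.Theorems.FrobeniusLadderFInjectiveMacaulayficationOneParameterIdeal
import Summits.ResolutionOfSingularities.ResolutionOfSingularities.Theorems.FrobeniusLadderFInjectiveMacaulayficationPartialSop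
import Literature.RingTheory.TightClosure.TightClosure
import HarnessLib

/-!
# Frobenius-closedness of parameter ideals localizes (crux `FrobeniusLadder.FInjectiveMacaulayfication`, line `Sketch`)

Helper stub `stub_frobeniusClosedLocalizes` of the skeleton `Sketch` for crux
stmt-ResolutionOfSingularities-15315 (route `FrobeniusLadder`, rung 2; cycle 4, wave 2 "the clause
localizes").  Let `(R, 𝔪)` be a Noetherian local ring of prime characteristic `p` satisfying the
crux's per-stalk clause in `IsSystemOfParameters` form: every system of parameters is a weakly
regular sequence and generates a Frobenius closed ideal.  Let `P` be a prime ideal, and suppose we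
are given a system of parameters `Fin.append x t` of `R` whose head `x` (of length `h = ht P`) lies
in `P` with `P` minimal over `(x)`, and that `R_P` is Cohen–Macaulay in the route's sense (every
system of parameters of `R_P` is weakly regular — the neighbouring stub `stub_cmLocalizes`).  Then
every ideal of `R_P` generated by a system of parameters is Frobenius closed (stated in the crux's
inline form `y^q ∈ (u)^[q] ⇒ y ∈ (u)`).

Proof.
1. `(x)` is Frobenius closed in `R` — an initial segment of a system of parameters
   (`PartialSop.isFrobeniusClosed_span_range_of_append`, Krull's intersection theorem).
2. Frobenius-closedness passes to localizations (`isFrobeniusClosed_map_of_isLocalization`): if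
   `z = y/w ∈ M⁻¹R` has `z^q ∈ (I·M⁻¹R)^[q] = I^[q]·M⁻¹R` (`Fedder.frobeniusPower_map`), then
   `c·y^q ∈ I^[q]` for some `c ∈ M`, so `(c y)^q = c^(q-1)·(c y^q) ∈ I^[q]`, `c y ∈ I^F = I` and
   `z ∈ I·M⁻¹R`.
3. The images of `x` in `R_P` form a system of parameters: `dim R_P = ht P = h`
   (`IsLocalization.AtPrime.ringKrullDim_eq_height`) and `rad ((x) R_P) = P R_P = 𝔪_{R_P}` because
   `P` is minimal over `(x)` (`IsLocalization.AtPrime.radical_map_of_mem_minimalPrimes`).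
4. One Frobenius closed parameter ideal of a Cohen–Macaulay local ring makes all of them Frobenius
   closed (`OneSop.isFrobeniusClosed_of_isFrobeniusClosed_sop`, Fedder 1983 / Quy–Shimomoto 2017 §3).

## References

* [QuyShimomoto2017] P. H. Quy, K. Shimomoto, *F-injectivity and Frobenius closure of ideals in
  Noetherian rings of characteristic p > 0*, Adv. Math. 313 (2017) 127–166, §3.
* [DattaMurayama2020] R. Datta, T. Murayama, *Permanence properties of F-injectivity*,
  arXiv:1906.11399 (F-injectivity localizes) — the local-cohomology original of the statement.
* [Fedder1983] R. Fedder, *F-purity and rational singularity*, Trans. AMS 278 (1983), Thm. 1.12.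
-/

-- single-problem summit: the doubled namespace component is forced
set_option linter.dupNamespace false

open Literature.RingTheory.TightClosure IsLocalRing

namespace Summit.ResolutionOfSingularities.ResolutionOfSingularities.Theorems.FInjectiveMacaulayfication.FrobeniusClosedLocalizes

/-! ## §1 Frobenius closure under localization -/

/-- **Frobenius-closedness localizes**: if `I` is a Frobenius closed ideal of `A` and `S = M⁻¹A` is a
localization (both of exponential characteristic `p`), then `I S` is Frobenius closed.  For
`z = y/w` with `z^q ∈ (I S)^[q] = I^[q] S` one finds `c ∈ M` with `c y^q ∈ I^[q]`; then
`(c y)^q = c^(q-1) (c y^q) ∈ I^[q]`, so `c y ∈ I` and `z = (c y)/(c w) ∈ I S`. [folklore] -/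
theorem isFrobeniusClosed_map_of_isLocalization {A : Type*} [CommRing A] (M : Submonoid A)
    (S : Type*) [CommRing S] [Algebra A S] [IsLocalization M S] (p : ℕ) [ExpChar A p] [ExpChar S p]
    {I : Ideal A} (hI : IsFrobeniusClosed p I) :
    IsFrobeniusClosed p (I.map (algebraMap A S)) := by
  rw [isFrobeniusClosed_iff_le]
  rintro z ⟨e, hz⟩
  rw [Fedder.frobeniusPower_map] at hz
  obtain ⟨y, w, rfl⟩ := IsLocalization.exists_mk'_eq M z
  rw [← IsLocalization.mk'_pow, IsLocalization.mk'_mem_map_algebraMap_iff M] at hz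
  obtain ⟨c, hcM, hc⟩ := hz
  rw [IsLocalization.mk'_mem_map_algebraMap_iff M]
  refine ⟨c, hcM, hI.le ⟨e, ?_⟩⟩
  have hq : p ^ e ≠ 0 := (expChar_pow_pos A p e).ne'
  have key : (c * y) ^ p ^ e = c ^ (p ^ e - 1) * (c * y ^ p ^ e) := by
    rw [mul_pow, ← mul_assoc, pow_sub_one_mul hq]
  rw [key]
  exact Ideal.mul_mem_left _ _ hc

/-! ## §2 The local ring `R_P`: characteristic and a system of parameters through `P` -/

/-- `R_P` has characteristic `p` if `R` has (`p · 1 = 0` is preserved by `algebraMap`, and `R_P` is a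
nontrivial local ring). [folklore] -/
theorem charP_localizationAtPrime {R : Type*} [CommRing R] (p : ℕ) [Fact p.Prime] [CharP R p]
    (P : Ideal R) [P.IsPrime] : CharP (Localization.AtPrime P) p := by
  have hp : (p : Localization.AtPrime P) = 0 := by
    rw [← map_natCast (algebraMap R (Localization.AtPrime P)) p, CharP.cast_eq_zero, map_zero]
  exact (CharP.charP_iff_prime_eq_zero Fact.out).mpr hp

/-- The ideal of `R_P` generated by the images of `x` is the extension `(x) R_P`. [folklore] -/
theorem span_range_algebraMap {R : Type*} [CommRing R] (S : Type*) [CommRing S] [Algebra R S]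
    {h : ℕ} (x : Fin h → R) :
    Ideal.span (Set.range fun i => algebraMap R S (x i)) =
      (Ideal.span (Set.range x)).map (algebraMap R S) := by
  rw [Ideal.map_span, ← Set.range_comp]
  rfl

/-- **A system of parameters of `R_P` coming from `R`.**  If `P` is a prime of height `h` minimal over
the ideal `(x)` generated by `h` elements, then the images of `x` in `R_P` form a system of parameters:
`dim R_P = ht P = h` and `rad ((x) R_P) = P R_P` is the maximal ideal. [folklore] -/
theorem isSystemOfParameters_algebraMap {R : Type*} [CommRing R] (P : Ideal R) [P.IsPrime]
    {h : ℕ} (x : Fin h → R) (hPmin : P ∈ (Ideal.span (Set.range x)).minimalPrimes)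
    (hPh : P.height = h) :
    IsSystemOfParameters (fun i => algebraMap R (Localization.AtPrime P) (x i)) := by
  refine ⟨?_, ?_⟩
  · rw [IsLocalization.AtPrime.ringKrullDim_eq_height P (Localization.AtPrime P), hPh]
    rfl
  · rw [span_range_algebraMap,
      IsLocalization.AtPrime.radical_map_of_mem_minimalPrimes (Localization.AtPrime P) P _ hPmin,
      Localization.AtPrime.map_eq_maximalIdeal]

/-! ## §3 The stub -/

/-- **Frobenius-closedness of parameter ideals localizes** (helper stub `stub_frobeniusClosedLocalizes`,
cycle 4 wave 2).  Let `(R, 𝔪)` be a Noetherian local ring of characteristic `p` all of whose systems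
of parameters are weakly regular with Frobenius closed ideal, `P` a prime, `Fin.append x t` a system of
parameters of `R` with `x ⊆ P`, `P` minimal over `(x)` and `ht P = |x|`, and assume every system of
parameters of `R_P` is weakly regular.  Then every ideal of `R_P` generated by a system of parameters
`u` is Frobenius closed (inline form): `(x)` is Frobenius closed in `R`
(`PartialSop.isFrobeniusClosed_span_range_of_append`), hence `(x) R_P` is Frobenius closed
(`isFrobeniusClosed_map_of_isLocalization`); the images of `x` form a system of parameters of `R_P`
(`isSystemOfParameters_algebraMap`); and one Frobenius closed parameter ideal of a Cohen–Macaulay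
local ring makes all of them Frobenius closed (`OneSop.isFrobeniusClosed_of_isFrobeniusClosed_sop`).
[folklore] -/
theorem stub_frobeniusClosedLocalizes : ∀ (p : ℕ) [Fact p.Prime] (R : Type) [CommRing R]
    [IsNoetherianRing R] [IsLocalRing R] [CharP R p],
    (∀ ⦃n : ℕ⦄ (u : Fin n → R), Literature.RingTheory.TightClosure.IsSystemOfParameters u →
        RingTheory.Sequence.IsWeaklyRegular R (List.ofFn u) ∧
        Literature.RingTheory.TightClosure.IsFrobeniusClosed p (Ideal.span (Set.range u))) →
    ∀ (P : Ideal R) [P.IsPrime] (h e : ℕ) (x : Fin h → R) (t : Fin e → R),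
      Literature.RingTheory.TightClosure.IsSystemOfParameters (Fin.append x t) → (∀ i, x i ∈ P) →
      P ∈ (Ideal.span (Set.range x)).minimalPrimes → P.height = h →
      (∀ ⦃n : ℕ⦄ (u : Fin n → Localization.AtPrime P),
        Literature.RingTheory.TightClosure.IsSystemOfParameters u →
        RingTheory.Sequence.IsWeaklyRegular (Localization.AtPrime P) (List.ofFn u)) →
      ∀ ⦃n : ℕ⦄ (u : Fin n → Localization.AtPrime P),
        Literature.RingTheory.TightClosure.IsSystemOfParameters u →
        ∀ y : Localization.AtPrime P, (∃ e : ℕ, y ^ p ^ e ∈ Ideal.span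
          ((fun z : Localization.AtPrime P => z ^ p ^ e) ''
            (Ideal.span (Set.range u) : Set (Localization.AtPrime P)))) → y ∈ Ideal.span (Set.range u) := by
  intro p _ R _ _ _ _ hR P _ h e x t hxt _hxP hPmin hPh hCMP n u hu
  haveI : CharP (Localization.AtPrime P) p := charP_localizationAtPrime p P
  -- (1) `(x)` is Frobenius closed in `R`
  have hfcx : IsFrobeniusClosed p (Ideal.span (Set.range x)) :=
    PartialSop.isFrobeniusClosed_span_range_of_append p R hR x t hxt
  -- (2) `(x) R_P` is Frobenius closed in `R_P`
  have hfcx' : IsFrobeniusClosed p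
      (Ideal.span (Set.range fun i => algebraMap R (Localization.AtPrime P) (x i))) := by
    rw [span_range_algebraMap]
    exact isFrobeniusClosed_map_of_isLocalization P.primeCompl (Localization.AtPrime P) p hfcx
  -- (3) the images of `x` form a system of parameters of `R_P`
  have hx' : IsSystemOfParameters (fun i => algebraMap R (Localization.AtPrime P) (x i)) :=
    isSystemOfParameters_algebraMap P x hPmin hPh
  -- (4) `n = h`, and one Frobenius closed parameter ideal makes all of them Frobenius closed
  obtain rfl : n = h := by
    have h1 := hu.1
    rw [hx'.1] at h1
    exact_mod_cast h1.symm
  exact (isFrobeniusClosed_iff p).mp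
    (OneSop.isFrobeniusClosed_of_isFrobeniusClosed_sop p hCMP hx' hu hfcx')

end Summit.ResolutionOfSingularities.ResolutionOfSingularities.Theorems.FInjectiveMacaulayfication.FrobeniusClosedLocalizes
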